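/-
Copyright (c) 2026 the pub-hodgecm-mathlib formalisation cell (harness21).  Prover seat hodgecm-mathlib-LH4-p17 (g3); K1a desk K2Liu-p01 (g11) «p17: PEN» 2026-09-05T02:45:30Z,
letter (b) `hpw` of ★ p864639 `K2LiuKindOneSingularGaussianDictionary.hgauss_of_cornerReading` = K2Liu-p03 (g8)'s (m1) «THE LEVI-TRANSLATE GAUSSIAN PARAMETER»; Track B «K2-LIT»,
#184♮ = hLiu418 = `stmt-HodgeConjecture-24832`.  THEOREMS ONLY (no `def`, no instance, no notation, no named-fact hypothesis, no `sorry`, default heartbeats).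
-/
import Summits.HodgeConjecture.HodgeConjecture.Theorems.K2LiuKindOneSingularCornerIndexDatum    -- ★ p864832 (this seat): the corner datum `(a_b, w σ)`
import Summits.HodgeConjecture.HodgeConjecture.Theorems.K2LiuHermitianTubeCocycle               -- ★ `moeb_levi_of_mem`, `moeb_mul_of_posDef`, `posDef_im_I_smul_one`
import HarnessLib

/-!
# Crux `HLiu418`, socket #41 K1-a♮ (L2-dock)(m1) — `K2LiuKindOneSingularCornerTranslateReading`: THE LEVI-TRANSLATE GAUSSIAN PARAMETER
# `p(m(A)·g) = ((a_1ᴴ·2V(m(A)·g)·a_1)₀₀).re = 2·Re(A·V(g)·Aᴴ)₁₁ = 2‖c_1‖²·Re⟨Γ_1, (D′V(g)D′ᴴ)ᵀ Γ_1⟩` at `A = diag c·Γ·diag c′` — ★ p864639's letters (b) `hpw` and (c) `hV`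

Cell `hodgecm-mathlib`, crux item hLiu418 = `stmt-HodgeConjecture-24832`, route `HCCMUnconditional`; squad K2 ∕ K2Liu (L1).  Lane `--supports stmt-HodgeConjecture-24832 --as helper`
(count-neutral).  CLOSES NO SOCKET.

THE SLOT.  ★ p864639 `K2LiuKindOneSingularGaussianDictionary.hgauss_of_cornerReading` takes BY VALUE `pw : Skew → H_𝔸 → InfinitePlace L → ℝ` and `V : InfinitePlace L → H_𝔸 → M₂(ℂ)`
with (b) `hpw : cp·Re⟨ι_{w'}γ̂₁, V w' h·ι_{w'}γ̂₁⟩ ≤ pw X h w'` (`γ̂₁` = row `1` of `γ[w X]`) and (c) `hV : cV·‖h‖^{−aV}·Σ‖v_k‖² ≤ Re⟨v, V w' h v⟩`.  The per-place continued letter is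
★ p864004 `exists_archLetters_scalarType_explicit{_neg}` whose Gaussian exponent at the frame-picture element `x` is `p(x) = ((aᴴ·(2•V(x))·a)₀₀).re`,
`V(x) = (2i)⁻¹•(moeb x (i•1) − (moeb x (i•1))ᴴ)`, at the datum `a = a_1` of ★ p864832 (`‖det a_1‖ = 1`, `a_1·hermTwo(y,0,0)·a_1ᴴ = single 1 1 y`; §1 adds `(a_1ᴴWa_1)₀₀ = W₁₁`).
The arch letter is evaluated at the LEVI TRANSLATE `x = Fr((gc X·h)_∞) w'`; LH4-p14 (g8)'s FINDING 02:52:11Z (her `K2LiuKindOneLineLeviFrameDictionary.frame_levi_of_record`): at the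
frames of record ★ `exists_tubeFrame_arch₄` (x) the Levi block is `D·ĝ^w·D⁻¹` — here BY VALUE as `hFrL : Fr((gc X·h)_∞) w = fromBlocks (diag(c w)·σ_w(γ̂ X)·diag(c′ w)) 0 0 (A′ X w)·Fr(h_∞) w`
with `hLevi : (diag c·σ_wγ̂·diag c′)ᴴ·A′ = 1` (membership in `U(J)`).  Then (§1 `im_moeb_base_levi_mul`, ★ `moeb_levi_of_mem` + `moeb_mul_of_posDef`) `V(m·g) = A·V(g)·Aᴴ`, and
(§1 `levi_conj_apply_same`) `(A·V·Aᴴ)₁₁ = c_1 c̄_1·⟨Γ_1, (diag c′·V·diag c′ᴴ)ᵀ Γ_1⟩` in ★ p864639's pairing `star v ⬝ᵥ (X *ᵥ v)`, `Γ = σ_w(γ̂ X)`, `v k = σ_{w'}(γ̂ 1 k)`.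
HENCE (§2 **`hpw_of_leviFrame`**) letter (b) holds WITH EQUALITY at `pw X h w' := p(Fr((gc X·h)_∞) w')` (★ p864004's exponent at `a = a_1`, VERBATIM),
`V w' h := (2‖c w' 1‖²)•(diag(c′ w')·V(Fr(h_∞) w')·diag(c′ w')ᴴ)ᵀ`, `cp := 1`; and (§3 **`hV_twisted_of_untwistedFloor`**) letter (c) for this twisted `V w' h` follows from the
(m2) floor on the UNtwisted `V(Fr(h_∞) w')` (`cV·ρ(h)·Σ‖v_k‖² ≤ Re⟨v, V(Fr(h_∞) w') v⟩`, `ρ h := ‖h‖^{−aV}` by value) with constant `κ·cV`, `κ ≤ 2‖c w' 1‖²‖c′ w' k‖²` on `Tinf`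
(`= 2|t₁|∕|t_k|` at the record).
THIS FILE (hypothesis-first; THEOREMS ONLY): §1 `im_moeb_base_levi_mul`, `exists_frame_single_apply`, `levi_conj_apply_same`, `re_dotProduct_smul_mulVec`,
`dotProduct_transpose_mulVec_eq`, `dotProduct_diagonal_conj_mulVec`, `norm_conj_mul_star_sq`; §2 **`hpw_of_leviFrame`**; §3 **`hV_twisted_of_untwistedFloor`**; §4 `frameConj_mul` (the `hFrL` payer's one-line bookkeeping).
HONEST LABEL.  Count-neutral helper (Levi∕moeb algebra); the Levi-frame letter `hFrL hLevi` (payer: LH4-p14 (g8)'s `frame_levi_of_record` + ★ `hFr`), the (m2) floor `hV0` (payer: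
the height hands, ★ `K2LiuArchBlockHeightBound.posSemidef_mul_conjTranspose_sub_smul`) and `κ` enter BY VALUE; `HC_CM` is proved only modulo the 7 printed citations (2 remaining
named inputs: hLiu418 = `stmt-HodgeConjecture-24832`, h413 = `stmt-HodgeConjecture-24833`) until rung 0 closes.

## References
* [Shimura1997] G. Shimura, *Euler Products and Eisenstein Series*, CBMS 93 (1997): §6.4 (Levi action on the tube), §18.1 (Fourier–Whittaker parameters).
* [Shimura1982] G. Shimura, *Confluent hypergeometric functions on tube domains*, Math. Ann. 260 (1982): §4 Thm. 4.2 (the Gaussian exponent).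
* [KudlaRallis1994] S. Kudla, S. Rallis, *A regularized Siegel–Weil formula: the first term identity*, Ann. of Math. 140 (1994): §2 (2.10)–(2.12).
-/

set_option autoImplicit false
set_option linter.dupNamespace false -- the mandated namespace repeats `HodgeConjecture.HodgeConjecture`

noncomputable section

open scoped Matrix ComplexConjugate
open Complex Matrix NumberField NumberField.InfinitePlace IsDedekindDomain
open Literature.NumberTheory.ModularForms.SiegelUpperHalfSpace (moeb)
open Literature.NumberTheory.Automorphic Literature.NumberTheory.Automorphic.UnitaryGroup Literature.NumberTheory.GaloisRepresentations
open Literature.NumberTheory.GelbartRogawski1991 Literature.NumberTheory.GelbartRogawski1991.GRConstruction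

namespace Summit.HodgeConjecture.HodgeConjecture.Cruxes.HLiu418.K2LiuKindOneSingularCornerTranslateReading

open K2LiuSiegelUnipotentFourierDefs
open K2LiuHermTwoGammaDefs (hermTwo)
open K2LiuHermitianTubeCocycle (moeb_levi_of_mem moeb_mul_of_posDef posDef_im_I_smul_one)
open K2LiuKindOneSingularCornerIndexDatum (hermTwo_eq_single swap_mul_hermTwo_mul_eq_single norm_det_swap)

/-! ## §1 Algebra: the imaginary part of the base point under a Levi translate, the coordinate reading `(a_bᴴ W a_b)₀₀ = W_bb`, and the `D`-twisted row form -/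

section Algebra

variable {l : Type*} [Fintype l] [DecidableEq l]

/-- **`V(m·g) = a·V(g)·aᴴ`** for `m = fromBlocks a 0 0 d` with `aᴴ * d = 1` and `g ∈ U(J)` (`gᴴJg = J`), `V(x) := (2i)⁻¹ • (moeb x (i•1) − (moeb x (i•1))ᴴ)`. [cite: Shimura1997, §6.4] -/
theorem im_moeb_base_levi_mul {a d : Matrix l l ℂ} (had : aᴴ * d = 1) {g : Matrix (l ⊕ l) (l ⊕ l) ℂ} (hg : gᴴ * Matrix.J l ℂ * g = Matrix.J l ℂ) :
    (2 * I)⁻¹ • (moeb (fromBlocks a 0 0 d * g) (I • (1 : Matrix l l ℂ)) - (moeb (fromBlocks a 0 0 d * g) (I • (1 : Matrix l l ℂ)))ᴴ) =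
      a * ((2 * I)⁻¹ • (moeb g (I • (1 : Matrix l l ℂ)) - (moeb g (I • (1 : Matrix l l ℂ)))ᴴ)) * aᴴ := by
  rw [moeb_mul_of_posDef hg posDef_im_I_smul_one, moeb_levi_of_mem had, conjTranspose_mul, conjTranspose_mul, conjTranspose_conjTranspose,
    ← Matrix.mul_assoc, ← Matrix.sub_mul, ← Matrix.mul_sub, ← Matrix.smul_mul, ← Matrix.mul_smul]

/-- **THE COORDINATE FRAME WITH ITS READING.**  For each `b : Fin 2` the frame `a_b` of ★ p864832 (`a_0 = 1`, `a_1 =` the swap; `‖det a_b‖ = 1`, `a_b·hermTwo(y,0,0)·a_bᴴ = single b b y`)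
ALSO reads the `(0,0)` entry of a conjugate as the `(b,b)` entry: `(a_bᴴ·W·a_b)₀₀ = W_bb` — so ★ p864004's exponent `((aᴴ·2V·a)₀₀).re` at `a = a_b` is `2·Re V_bb`. [cite: Shimura1982, §4 Thm. 4.2] -/
theorem exists_frame_single_apply (b : Fin 2) :
    ∃ a : Matrix (Fin 2) (Fin 2) ℂ, ‖a.det‖ = 1 ∧ (∀ y : ℝ, a * hermTwo (y, 0, 0) * aᴴ = Matrix.single b b (y : ℂ)) ∧
      ∀ W : Matrix (Fin 2) (Fin 2) ℂ, (aᴴ * W * a) 0 0 = W b b := by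
  fin_cases b
  · refine ⟨1, by rw [det_one, norm_one], fun y => by rw [one_mul, conjTranspose_one, mul_one, hermTwo_eq_single]; rfl, fun W => ?_⟩
    rw [conjTranspose_one, one_mul, mul_one]
    rfl
  · refine ⟨!![(0 : ℂ), 1; 1, 0], norm_det_swap, fun y => swap_mul_hermTwo_mul_eq_single y, fun W => ?_⟩
    simp [Matrix.mul_apply, Fin.sum_univ_two, conjTranspose_apply]

/-- **THE `D`-TWISTED ROW FORM.**  For diagonal `D = diag c`, `D′ = diag c′` and any `Γ V`:
`((DΓD′)·V·(DΓD′)ᴴ)_bb = c_b·c̄_b · ⟨Γ_b, (D′·V·D′ᴴ)ᵀ Γ_b⟩` with `⟨v, X v⟩ := star v ⬝ᵥ (X *ᵥ v)` and `Γ_b k := Γ b k` (★ p864639's row pairing). [cite: Shimura1997, §18.1] -/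
theorem levi_conj_apply_same (c c' : Fin 2 → ℂ) (Γ V : Matrix (Fin 2) (Fin 2) ℂ) (b : Fin 2) :
    (diagonal c * Γ * diagonal c' * V * (diagonal c * Γ * diagonal c')ᴴ) b b =
      c b * (starRingEnd ℂ) (c b) * (star (fun k => Γ b k) ⬝ᵥ ((diagonal c' * V * (diagonal c')ᴴ)ᵀ *ᵥ fun k => Γ b k)) := by
  fin_cases b <;>
    simp [Matrix.mul_apply, conjTranspose_apply, transpose_apply, diagonal_apply, dotProduct, mulVec, Fin.sum_univ_two] <;> ring

/-- `Re (star v ⬝ᵥ ((r • Xᵀ) *ᵥ v)) = r · Re (star v ⬝ᵥ (Xᵀ *ᵥ v))` for real `r` — the scalar comes out of ★ p864639's pairing. [folklore] -/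
theorem re_dotProduct_smul_mulVec (r : ℝ) (X : Matrix (Fin 2) (Fin 2) ℂ) (v : Fin 2 → ℂ) :
    (star v ⬝ᵥ (((r : ℂ) • X) *ᵥ v)).re = r * (star v ⬝ᵥ (X *ᵥ v)).re := by
  rw [smul_mulVec, dotProduct_smul, smul_eq_mul, re_ofReal_mul]

/-- `⟨v, Wᵀ v⟩ = ⟨v̄, W v̄⟩` (`v̄ = star v` entrywise): the transpose twist is a conjugation of the test vector. [folklore] -/
theorem dotProduct_transpose_mulVec_eq (W : Matrix (Fin 2) (Fin 2) ℂ) (v : Fin 2 → ℂ) :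
    star v ⬝ᵥ (Wᵀ *ᵥ v) = star (star v) ⬝ᵥ (W *ᵥ star v) := by
  simp [dotProduct, mulVec, Fin.sum_univ_two, transpose_apply]
  ring

/-- `⟨u, (D′·V·D′ᴴ) u⟩ = ⟨D′ᴴu, V·D′ᴴu⟩` for diagonal `D′ = diag c′` (`(D′ᴴu)_k = c̄′_k·u_k`). [folklore] -/
theorem dotProduct_diagonal_conj_mulVec (c' : Fin 2 → ℂ) (V : Matrix (Fin 2) (Fin 2) ℂ) (u : Fin 2 → ℂ) :
    star u ⬝ᵥ ((diagonal c' * V * (diagonal c')ᴴ) *ᵥ u) =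
      star (fun k => (starRingEnd ℂ) (c' k) * u k) ⬝ᵥ (V *ᵥ fun k => (starRingEnd ℂ) (c' k) * u k) := by
  simp [dotProduct, mulVec, Fin.sum_univ_two, Matrix.mul_apply, diagonal_apply]
  ring

/-- `‖c̄·v̄‖² = ‖c‖²·‖v‖²`. [folklore] -/
theorem norm_conj_mul_star_sq (c z : ℂ) : ‖(starRingEnd ℂ) c * star z‖ ^ 2 = ‖c‖ ^ 2 * ‖z‖ ^ 2 := by
  rw [norm_mul, Complex.norm_conj, Complex.star_def, Complex.norm_conj, mul_pow]

end Algebra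

/-! ## §2 At the K2_Liu frame: ★ p864639's letter (b) `hpw` from a Levi-frame letter BY VALUE (LH4-p14 (g8)'s `frame_levi_of_record` shape: Levi block `D·σ_w(γ̂)·D′`) -/

section Frame

variable (L : Type) [Field L] [NumberField L] [IsCMField L] {N M : ℕ} (e : Fin N × Fin M ≃ Fin 2)
  (dV : Fin N → L) (hdV : ∀ i, IsCMField.complexConj L (dV i) = dV i)
  (dW : Fin M → L) (hdW : ∀ i, IsCMField.complexConj L (dW i) = dW i)

/-- **★ p864639's LETTER (b) `hpw` FROM THE LEVI-FRAME LETTER — (m1) THE LEVI-TRANSLATE GAUSSIAN PARAMETER.**  INPUTS (by value): a row section `γ` with ★ (A)'s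
row witnesses `w hw` (so `γ̂ X := γ[w X]`); the corner translate `gc : Skew → H_𝔸`; a tube frame `Fr` landing in `U(J)` (`hFrU`, ★ `frame_mem`); the LEVI-FRAME LETTER
`hFrL : Fr((gc X·h)_∞) w = fromBlocks (diag(c w)·σ_w(γ̂ X)·diag(c′ w)) 0 0 (A′ X w) · Fr(h_∞) w` with `hLevi : (diag c·σ_w γ̂·diag c′)ᴴ·A′ = 1` (LH4-p14 (g8) FINDING 02:52:11Z:
at the frames of record ★ `exists_tubeFrame_arch₄` (x) the Levi block is `D·ĝ^w·D⁻¹`, `c w k = √(|t_k|∕2)`, `c′ = c⁻¹`; her `frame_levi_of_record` pays `hFrL hLevi`).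
OUTPUT: the coordinate frame `a = a_1` of ★ p864832 (`‖det a‖ = 1`, `a·hermTwo(y,0,0)·aᴴ = single 1 1 y`, `(aᴴWa)₀₀ = W₁₁`) TOGETHER WITH letter (b) in ★ p864639's bytes at
`pw X h w' := ((aᴴ·(2•V(Fr((gc X·h)_∞) w'))·a)₀₀).re` = ★ p864004's exponent `p` at the translate (`V(x) = (2i)⁻¹•(x⟨i⟩ − x⟨i⟩ᴴ)`),
`V w' h := (2‖c w' 1‖²) • (diag(c′ w')·V(Fr(h_∞) w')·diag(c′ w')ᴴ)ᵀ`, `cp := 1` — with EQUALITY (`V(m·g) = A·V(g)·Aᴴ`, §1). [cite: Shimura1997, §6.4, §18.1] [cite: KudlaRallis1994, §2 (2.10)–(2.12)] -/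
theorem hpw_of_leviFrame (Tinf : Finset (InfinitePlace L))
    (γ : Projectivization L (Fin 2 → L) → GL (Fin 2) L)
    (w : skewMatrices ((IsCMField.complexConj L : L ≃ₐ[Fp L] L) : L →+* L) ((gramR L e dV hdV dW hdW).map (algebraMap (Fp L) L)) → Fin 2 → L)
    (hw : ∀ S, w S ≠ 0)
    (gc : skewMatrices ((IsCMField.complexConj L : L ≃ₐ[Fp L] L) : L →+* L) ((gramR L e dV hdV dW hdW).map (algebraMap (Fp L) L)) → HA L e dV hdV dW hdW)
    (Fr : UnitaryGroup.arch (Fp L) L (IsCMField.complexConj L) (2 + 2) (hermD L e dV hdV dW hdW) → {w : InfinitePlace L // w.IsComplex} →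
      Matrix (Fin 2 ⊕ Fin 2) (Fin 2 ⊕ Fin 2) ℂ)
    (hFrU : ∀ (a : UnitaryGroup.arch (Fp L) L (IsCMField.complexConj L) (2 + 2) (hermD L e dV hdV dW hdW)) (w : {w : InfinitePlace L // w.IsComplex}),
      (Fr a w)ᴴ * Matrix.J (Fin 2) ℂ * Fr a w = Matrix.J (Fin 2) ℂ)
    (c c' : {w : InfinitePlace L // w.IsComplex} → Fin 2 → ℂ)
    (A' : skewMatrices ((IsCMField.complexConj L : L ≃ₐ[Fp L] L) : L →+* L) ((gramR L e dV hdV dW hdW).map (algebraMap (Fp L) L)) →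
      {w : InfinitePlace L // w.IsComplex} → Matrix (Fin 2) (Fin 2) ℂ)
    (hFrL : ∀ (X : skewMatrices ((IsCMField.complexConj L : L ≃ₐ[Fp L] L) : L →+* L) ((gramR L e dV hdV dW hdW).map (algebraMap (Fp L) L)))
      (h : HA L e dV hdV dW hdW) (w' : {w : InfinitePlace L // w.IsComplex}),
      Fr (UnitaryGroup.archPart (Fp L) L (IsCMField.complexConj L) (2 + 2) (hermD L e dV hdV dW hdW) (gc X * h)) w' =
        fromBlocks (diagonal (c w') * ((γ (Projectivization.mk L (w X) (hw X)) : GL (Fin 2) L) : Matrix (Fin 2) (Fin 2) L).map w'.1.embedding * diagonal (c' w'))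
          0 0 (A' X w') * Fr (UnitaryGroup.archPart (Fp L) L (IsCMField.complexConj L) (2 + 2) (hermD L e dV hdV dW hdW) h) w')
    (hLevi : ∀ (X : skewMatrices ((IsCMField.complexConj L : L ≃ₐ[Fp L] L) : L →+* L) ((gramR L e dV hdV dW hdW).map (algebraMap (Fp L) L)))
      (w' : {w : InfinitePlace L // w.IsComplex}),
      (diagonal (c w') * ((γ (Projectivization.mk L (w X) (hw X)) : GL (Fin 2) L) : Matrix (Fin 2) (Fin 2) L).map w'.1.embedding * diagonal (c' w'))ᴴ * A' X w' = 1) :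
    ∃ a : Matrix (Fin 2) (Fin 2) ℂ, ‖a.det‖ = 1 ∧ (∀ y : ℝ, a * hermTwo (y, 0, 0) * aᴴ = Matrix.single 1 1 (y : ℂ)) ∧
      (∀ W : Matrix (Fin 2) (Fin 2) ℂ, (aᴴ * W * a) 0 0 = W 1 1) ∧
      ∀ (X : skewMatrices ((IsCMField.complexConj L : L ≃ₐ[Fp L] L) : L →+* L) ((gramR L e dV hdV dW hdW).map (algebraMap (Fp L) L))) (h : HA L e dV hdV dW hdW),
        (X : Matrix (Fin 2) (Fin 2) L) ≠ 0 → (X : Matrix (Fin 2) (Fin 2) L).det = 0 → ∀ w' ∈ Tinf,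
          (1 : ℝ) * (star (fun k => w'.embedding (((γ (Projectivization.mk L (w X) (hw X)) : GL (Fin 2) L) : Matrix (Fin 2) (Fin 2) L) 1 k)) ⬝ᵥ
            ((((2 * ‖c ⟨w', IsTotallyComplex.isComplex w'⟩ 1‖ ^ 2 : ℝ) : ℂ) •
                (diagonal (c' ⟨w', IsTotallyComplex.isComplex w'⟩) *
                    ((2 * I)⁻¹ • (moeb (Fr (UnitaryGroup.archPart (Fp L) L (IsCMField.complexConj L) (2 + 2) (hermD L e dV hdV dW hdW) h) ⟨w', IsTotallyComplex.isComplex w'⟩)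
                        (I • (1 : Matrix (Fin 2) (Fin 2) ℂ)) -
                      (moeb (Fr (UnitaryGroup.archPart (Fp L) L (IsCMField.complexConj L) (2 + 2) (hermD L e dV hdV dW hdW) h) ⟨w', IsTotallyComplex.isComplex w'⟩)
                        (I • (1 : Matrix (Fin 2) (Fin 2) ℂ)))ᴴ)) *
                  (diagonal (c' ⟨w', IsTotallyComplex.isComplex w'⟩))ᴴ)ᵀ) *ᵥ
              fun k => w'.embedding (((γ (Projectivization.mk L (w X) (hw X)) : GL (Fin 2) L) : Matrix (Fin 2) (Fin 2) L) 1 k))).re ≤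
          ((aᴴ * ((2 : ℂ) • ((2 * I)⁻¹ •
              (moeb (Fr (UnitaryGroup.archPart (Fp L) L (IsCMField.complexConj L) (2 + 2) (hermD L e dV hdV dW hdW) (gc X * h)) ⟨w', IsTotallyComplex.isComplex w'⟩)
                  (I • (1 : Matrix (Fin 2) (Fin 2) ℂ)) -
                (moeb (Fr (UnitaryGroup.archPart (Fp L) L (IsCMField.complexConj L) (2 + 2) (hermD L e dV hdV dW hdW) (gc X * h)) ⟨w', IsTotallyComplex.isComplex w'⟩)
                  (I • (1 : Matrix (Fin 2) (Fin 2) ℂ)))ᴴ))) * a) 0 0).re := by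
  obtain ⟨a, ha, hay, haW⟩ := exists_frame_single_apply 1
  refine ⟨a, ha, hay, haW, fun X h _ _ w' _ => le_of_eq ?_⟩
  set wc : {w : InfinitePlace L // w.IsComplex} := ⟨w', IsTotallyComplex.isComplex w'⟩ with hwc
  set Γ : Matrix (Fin 2) (Fin 2) ℂ := ((γ (Projectivization.mk L (w X) (hw X)) : GL (Fin 2) L) : Matrix (Fin 2) (Fin 2) L).map w'.embedding with hΓ
  have hv : (fun k => w'.embedding (((γ (Projectivization.mk L (w X) (hw X)) : GL (Fin 2) L) : Matrix (Fin 2) (Fin 2) L) 1 k)) = fun k => Γ 1 k := rfl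
  rw [one_mul, hv, re_dotProduct_smul_mulVec, haW, hFrL X h wc,
    im_moeb_base_levi_mul (hLevi X wc) (hFrU (UnitaryGroup.archPart (Fp L) L (IsCMField.complexConj L) (2 + 2) (hermD L e dV hdV dW hdW) h) wc),
    Matrix.smul_apply, smul_eq_mul, show wc.1.embedding = w'.embedding from rfl, ← hΓ, levi_conj_apply_same, Complex.mul_conj, Complex.normSq_eq_norm_sq]
  simp only [Complex.mul_re, Complex.ofReal_re, Complex.ofReal_im, zero_mul, sub_zero, Complex.re_ofNat, Complex.im_ofNat]
  ring

end Frame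

/-! ## §3 ★ p864639's letter (c) `hV` at the twisted `V w' h` from a floor on the untwisted `V(Fr(h_∞) w')` ((m2)'s natural statement) -/

section Floor

variable (L : Type) [Field L] [NumberField L] [IsCMField L] {N M : ℕ} (e : Fin N × Fin M ≃ Fin 2)
  (dV : Fin N → L) (hdV : ∀ i, IsCMField.complexConj L (dV i) = dV i)
  (dW : Fin M → L) (hdW : ∀ i, IsCMField.complexConj L (dW i) = dW i)

/-- **★ p864639's LETTER (c) TRANSPORTED TO THE TWISTED `V w' h`.**  If the untwisted imaginary part `V(Fr(h_∞) w')` has the (m2) floor `cV·ρ(h)·Σ‖v_k‖² ≤ Re⟨v, V(Fr(h_∞) w') v⟩`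
(`ρ ≥ 0` by value — the consumer's `ρ h := ‖h‖^{−aV}`), and `κ ≤ 2‖c w' 1‖²·‖c′ w' k‖²` on `Tinf` (at the frames of record `2‖c_1‖²‖c′_k‖² = 2|t₁|∕|t_k|`), then §2's twisted letter
`V w' h := (2‖c w' 1‖²)•(diag(c′ w')·V(Fr(h_∞) w')·diag(c′ w')ᴴ)ᵀ` has the floor with constant `κ·cV`: `(κ·cV)·ρ(h)·Σ‖v_k‖² ≤ Re⟨v, V w' h v⟩`. [cite: Shimura1997, §6.4] [cite: KudlaRallis1994, §2] -/
theorem hV_twisted_of_untwistedFloor (Tinf : Finset (InfinitePlace L))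
    (Fr : UnitaryGroup.arch (Fp L) L (IsCMField.complexConj L) (2 + 2) (hermD L e dV hdV dW hdW) → {w : InfinitePlace L // w.IsComplex} →
      Matrix (Fin 2 ⊕ Fin 2) (Fin 2 ⊕ Fin 2) ℂ)
    (c c' : {w : InfinitePlace L // w.IsComplex} → Fin 2 → ℂ) (ρ : HA L e dV hdV dW hdW → ℝ) (hρ : ∀ h, 0 ≤ ρ h) {cV κ : ℝ} (hcV : 0 ≤ cV)
    (hκ : ∀ w' ∈ Tinf, ∀ k : Fin 2, κ ≤ 2 * ‖c ⟨w', IsTotallyComplex.isComplex w'⟩ 1‖ ^ 2 * ‖c' ⟨w', IsTotallyComplex.isComplex w'⟩ k‖ ^ 2)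
    (hV0 : ∀ (h : HA L e dV hdV dW hdW), ∀ w' ∈ Tinf, ∀ v : Fin 2 → ℂ,
      cV * ρ h * ∑ k, ‖v k‖ ^ 2 ≤
        (star v ⬝ᵥ (((2 * I)⁻¹ • (moeb (Fr (UnitaryGroup.archPart (Fp L) L (IsCMField.complexConj L) (2 + 2) (hermD L e dV hdV dW hdW) h) ⟨w', IsTotallyComplex.isComplex w'⟩)
              (I • (1 : Matrix (Fin 2) (Fin 2) ℂ)) -
            (moeb (Fr (UnitaryGroup.archPart (Fp L) L (IsCMField.complexConj L) (2 + 2) (hermD L e dV hdV dW hdW) h) ⟨w', IsTotallyComplex.isComplex w'⟩)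
              (I • (1 : Matrix (Fin 2) (Fin 2) ℂ)))ᴴ)) *ᵥ v)).re) :
    ∀ (h : HA L e dV hdV dW hdW), ∀ w' ∈ Tinf, ∀ v : Fin 2 → ℂ,
      κ * cV * ρ h * ∑ k, ‖v k‖ ^ 2 ≤
        (star v ⬝ᵥ
          ((((2 * ‖c ⟨w', IsTotallyComplex.isComplex w'⟩ 1‖ ^ 2 : ℝ) : ℂ) •
              (diagonal (c' ⟨w', IsTotallyComplex.isComplex w'⟩) *
                  ((2 * I)⁻¹ • (moeb (Fr (UnitaryGroup.archPart (Fp L) L (IsCMField.complexConj L) (2 + 2) (hermD L e dV hdV dW hdW) h) ⟨w', IsTotallyComplex.isComplex w'⟩)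
                      (I • (1 : Matrix (Fin 2) (Fin 2) ℂ)) -
                    (moeb (Fr (UnitaryGroup.archPart (Fp L) L (IsCMField.complexConj L) (2 + 2) (hermD L e dV hdV dW hdW) h) ⟨w', IsTotallyComplex.isComplex w'⟩)
                      (I • (1 : Matrix (Fin 2) (Fin 2) ℂ)))ᴴ)) *
                (diagonal (c' ⟨w', IsTotallyComplex.isComplex w'⟩))ᴴ)ᵀ) *ᵥ v)).re := by
  intro h w' hw' v
  set wc : {w : InfinitePlace L // w.IsComplex} := ⟨w', IsTotallyComplex.isComplex w'⟩ with hwc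
  set V : Matrix (Fin 2) (Fin 2) ℂ := (2 * I)⁻¹ • (moeb (Fr (UnitaryGroup.archPart (Fp L) L (IsCMField.complexConj L) (2 + 2) (hermD L e dV hdV dW hdW) h) wc)
      (I • (1 : Matrix (Fin 2) (Fin 2) ℂ)) - (moeb (Fr (UnitaryGroup.archPart (Fp L) L (IsCMField.complexConj L) (2 + 2) (hermD L e dV hdV dW hdW) h) wc)
      (I • (1 : Matrix (Fin 2) (Fin 2) ℂ)))ᴴ) with hV
  set r : ℝ := 2 * ‖c wc 1‖ ^ 2 with hr
  have hr0 : 0 ≤ r := by positivity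
  -- the twisted pairing is `r·⟨u′, V u′⟩` at `u′ k := c̄′_k · v̄_k`
  rw [re_dotProduct_smul_mulVec, dotProduct_transpose_mulVec_eq, dotProduct_diagonal_conj_mulVec]
  have hfloor := hV0 h w' hw' (fun k => (starRingEnd ℂ) (c' wc k) * star v k)
  have hsum : κ * ∑ k, ‖v k‖ ^ 2 ≤ r * ∑ k, ‖(starRingEnd ℂ) (c' wc k) * star v k‖ ^ 2 := by
    rw [Finset.mul_sum, Finset.mul_sum]
    refine Finset.sum_le_sum fun k _ => ?_
    rw [show star v k = star (v k) from rfl, norm_conj_mul_star_sq, ← mul_assoc]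
    exact mul_le_mul_of_nonneg_right (hκ w' hw' k) (sq_nonneg _)
  calc κ * cV * ρ h * ∑ k, ‖v k‖ ^ 2 = cV * ρ h * (κ * ∑ k, ‖v k‖ ^ 2) := by ring
    _ ≤ cV * ρ h * (r * ∑ k, ‖(starRingEnd ℂ) (c' wc k) * star v k‖ ^ 2) := mul_le_mul_of_nonneg_left hsum (mul_nonneg hcV (hρ h))
    _ = r * (cV * ρ h * ∑ k, ‖(starRingEnd ℂ) (c' wc k) * star v k‖ ^ 2) := by ring
    _ ≤ r * (star (fun k => (starRingEnd ℂ) (c' wc k) * star v k) ⬝ᵥ (V *ᵥ fun k => (starRingEnd ℂ) (c' wc k) * star v k)).re :=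
        mul_le_mul_of_nonneg_left hfloor hr0

end Floor

/-! ## §4 Frame bookkeeping for the payer of `hFrL`: conjugation by the frame is multiplicative (`Tinv·T = 1`) -/

section Bookkeeping

variable {ι : Type*} [Fintype ι] [DecidableEq ι]

/-- **`T·(R_X·R_h)·T⁻¹ = (T·R_X·T⁻¹)·(T·R_h·T⁻¹)`** — so the frame of a product `Fr((gc X·h)_∞) w = T_w·ι(gc X·h)_w·T_w⁻¹` (★ `hFr` of record, `ι` multiplicative) is the framed Levi block
(★ p864846 `K2LiuKindOneLineLeviFrameDictionary.frame_archAt_levi_of_record`: `T_w·ι(Λ₀γ̂)_w·T_w⁻¹ = fromBlocks (diag c·σ_wγ̂·diag c′) 0 0 (…)`) times `Fr(h_∞) w` — the letter `hFrL` of §2.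
[cite: Shimura1997, §6.4] -/
theorem frameConj_mul {T Tinv : Matrix ι ι ℂ} (hT2 : Tinv * T = 1) (RX Rh : Matrix ι ι ℂ) :
    T * (RX * Rh) * Tinv = T * RX * Tinv * (T * Rh * Tinv) := by
  calc T * (RX * Rh) * Tinv = T * RX * (Tinv * T) * Rh * Tinv := by rw [hT2, Matrix.mul_one, Matrix.mul_assoc T RX Rh]
    _ = T * RX * Tinv * (T * Rh * Tinv) := by simp only [Matrix.mul_assoc]

end Bookkeeping

end Summit.HodgeConjecture.HodgeConjecture.Cruxes.HLiu418.K2LiuKindOneSingularCornerTranslateReading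

end
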